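import Summits.ResolutionOfSingularities.ResolutionOfSingularities.Theses.WildQuotients
import Literature.AlgebraicGeometry.Resolution.AlterationsSemiStable
import Literature.AlgebraicGeometry.Resolution.AlterationsStrong
import Literature.AlgebraicGeometry.Resolution.StrictNormalCrossings

/-!
# Crux-ideate sketch — `WildQuotients.SummitReduction` (stmt-ResolutionOfSingularities-16324),
# round 1, ideator k = 1

First lemmas of the three crux ideas, typed over existing declarations (no proofs except the two
pure-logic compositions, which are kernel-checked):

* card `perfect-squeeze`      : `FramePerfect`, `GaloisReductionPerfect`,
                                `summitReduction_of_perfect` (PROVED composition),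
                                `wqPerfectAt_of_wqAt` (PROVED);
* card `temkin-stable-modification` : `TemkinStableModification` (Temkin 2010 Thm 1.5, de Jong
                                format), `TemkinEquivariance` (Cor 1.6, finite-group form);
* card `functorial-log-endgame` : `EquivariantSemiStablePairResolution` (dJ97 Prop 5.11 without
                                quasi-split / G-strict hypotheses, any field).
-/

set_option linter.dupNamespace false

noncomputable section

open CategoryTheory CategoryTheory.Limits AlgebraicGeometry TopologicalSpace

open Literature.AlgebraicGeometry.Resolution

namespace Summit.ResolutionOfSingularities.ResolutionOfSingularities.Cruxes.SummitReduction.Ideator1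

/-! ## Per-prime bodies of the route's decls (verbatim binders) -/

/-- `WQ_p`: the body of `WildQuotients.WildQuotientResolution` at the prime `p`. -/
def WQAt (p : ℕ) : Prop :=
  ∀ (k : Type) [Field k] [CharP k p] (X' X₁ : AlgebraicGeometry.Scheme.{0})
    (f : X₁ ⟶ AlgebraicGeometry.Spec (.of k)) (q : X' ⟶ X₁) (G : Type) [Group G] [Finite G]
    (ρ : G →* CategoryTheory.Aut X'),
    AlgebraicGeometry.IsSeparated f → AlgebraicGeometry.LocallyOfFiniteType f →
    AlgebraicGeometry.QuasiCompact f → AlgebraicGeometry.IsIntegral X₁ →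
    AlgebraicGeometry.IsIntegral X' → Literature.AlgebraicGeometry.Resolution.Scheme.IsRegular X' →
    AlgebraicGeometry.IsFinite q → Function.Surjective q.base →
    (∃ U : X₁.Opens, Dense (U : Set X₁) ∧ AlgebraicGeometry.Etale (AlgebraicGeometry.morphismRestrict q U)) →
    (∀ g : G, CategoryTheory.CategoryStruct.comp (ρ g).hom q = q) →
    (∀ x y : X', q.base x = q.base y → ∃ g : G, (ρ g).hom.base x = y) →
    Literature.AlgebraicGeometry.Resolution.Scheme.HasResolution X₁

/-- `WQ_p^perf`: the same over PERFECT ground fields only. -/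
def WQPerfectAt (p : ℕ) : Prop :=
  ∀ (k : Type) [Field k] [CharP k p] [PerfectField k] (X' X₁ : AlgebraicGeometry.Scheme.{0})
    (f : X₁ ⟶ AlgebraicGeometry.Spec (.of k)) (q : X' ⟶ X₁) (G : Type) [Group G] [Finite G]
    (ρ : G →* CategoryTheory.Aut X'),
    AlgebraicGeometry.IsSeparated f → AlgebraicGeometry.LocallyOfFiniteType f →
    AlgebraicGeometry.QuasiCompact f → AlgebraicGeometry.IsIntegral X₁ →
    AlgebraicGeometry.IsIntegral X' → Literature.AlgebraicGeometry.Resolution.Scheme.IsRegular X' →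
    AlgebraicGeometry.IsFinite q → Function.Surjective q.base →
    (∃ U : X₁.Opens, Dense (U : Set X₁) ∧ AlgebraicGeometry.Etale (AlgebraicGeometry.morphismRestrict q U)) →
    (∀ g : G, CategoryTheory.CategoryStruct.comp (ρ g).hom q = q) →
    (∀ x y : X', q.base x = q.base y → ∃ g : G, (ρ g).hom.base x = y) →
    Literature.AlgebraicGeometry.Resolution.Scheme.HasResolution X₁

/-- `PIAlt_p`: the body of `WildQuotients.Pialt` (= pAlteration stmt-0555) at the prime `p`,
i.e. the `hPI` hypothesis of `Theorems.hasResolution_of_thesis p`. -/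
def PialtAt (p : ℕ) : Prop :=
  ∀ (k : Type) [Field k] [CharP k p] (X : AlgebraicGeometry.Scheme.{0})
    (f : X ⟶ AlgebraicGeometry.Spec (.of k)),
    AlgebraicGeometry.IsSeparated f → AlgebraicGeometry.LocallyOfFiniteType f →
    AlgebraicGeometry.QuasiCompact f → AlgebraicGeometry.IsIntegral X →
    ∃ (X' : AlgebraicGeometry.Scheme.{0}) (g : X' ⟶ X), AlgebraicGeometry.IsProper g ∧
      AlgebraicGeometry.IsIntegral X' ∧ Literature.AlgebraicGeometry.Resolution.Scheme.IsRegular X' ∧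
      Function.Surjective g.base ∧ ∃ U : X.Opens, Dense (U : Set X) ∧
      AlgebraicGeometry.IsFinite (AlgebraicGeometry.morphismRestrict g U) ∧
      AlgebraicGeometry.UniversallyInjective (AlgebraicGeometry.morphismRestrict g U)

/-- `PIAlt_p^perf`: the same over PERFECT ground fields only — the only instances of `hPI`
that pAlteration's proved frame ever consumes (`Theorems.hasResolution_of_pialt_picover_perfectField`,
Step 1, applied at `K = PerfectClosure k p`). -/
def PialtPerfectAt (p : ℕ) : Prop :=
  ∀ (k : Type) [Field k] [CharP k p] [PerfectField k] (X : AlgebraicGeometry.Scheme.{0})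
    (f : X ⟶ AlgebraicGeometry.Spec (.of k)),
    AlgebraicGeometry.IsSeparated f → AlgebraicGeometry.LocallyOfFiniteType f →
    AlgebraicGeometry.QuasiCompact f → AlgebraicGeometry.IsIntegral X →
    ∃ (X' : AlgebraicGeometry.Scheme.{0}) (g : X' ⟶ X), AlgebraicGeometry.IsProper g ∧
      AlgebraicGeometry.IsIntegral X' ∧ Literature.AlgebraicGeometry.Resolution.Scheme.IsRegular X' ∧
      Function.Surjective g.base ∧ ∃ U : X.Opens, Dense (U : Set X) ∧
      AlgebraicGeometry.IsFinite (AlgebraicGeometry.morphismRestrict g U) ∧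
      AlgebraicGeometry.UniversallyInjective (AlgebraicGeometry.morphismRestrict g U)

/-- `PICover_p`: the body of `WildQuotients.Picover` (= pAlteration stmt-0554) at the prime `p`. -/
def PicoverAt (p : ℕ) : Prop :=
  ∀ (k : Type) [Field k] [CharP k p] (Y X : AlgebraicGeometry.Scheme.{0})
    (f : Y ⟶ AlgebraicGeometry.Spec (.of k)) (g : X ⟶ Y),
    AlgebraicGeometry.IsSeparated f → AlgebraicGeometry.LocallyOfFiniteType f →
    AlgebraicGeometry.QuasiCompact f → AlgebraicGeometry.IsIntegral Y →
    Literature.AlgebraicGeometry.Resolution.Scheme.IsRegular Y → AlgebraicGeometry.IsIntegral X →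
    AlgebraicGeometry.IsFinite g → AlgebraicGeometry.UniversallyInjective g →
    Function.Surjective g.base → Literature.AlgebraicGeometry.Resolution.Scheme.HasResolution X

/-- Monotonicity: `WQ_p` over all fields gives `WQ_p` over perfect fields. [folklore] -/
theorem wqPerfectAt_of_wqAt {p : ℕ} (h : WQAt p) : WQPerfectAt p := by
  intro k _ _ _ X' X₁ f q G _ _ ρ
  exact h k X' X₁ f q G ρ

/-! ## Card `perfect-squeeze` -/

/-- FIRST LEMMA of card `perfect-squeeze` — **pAlteration's proved per-prime frame with the
purely-inseparable-alteration hypothesis restricted to PERFECT ground fields**: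
`PIAlt_p^perf ∧ PICover_p ⇒ ResolutionInChar p`. Provable NOW by binder surgery (add
`[PerfectField k]` to `hPI`) along the proved chain
`hasResolution_of_pialt_picover_perfectField` (hPI applied once, at a perfect `K`) →
`exists_resolution_perfectClosure` (applied at `PerfectClosure k p`) → `exists_level_model` →
`hasResolution_of_thesis` → `PAlteration.DescentReducedToIntegral_holds`; no other site
consumes `hPI` (grep `hPI` in `Theorems/PAlterationAssembly{,LevelModel,PerfectBase,Perfect}.lean`). -/
def FramePerfect : Prop :=
  ∀ p : ℕ, p.Prime → PialtPerfectAt p → PicoverAt p →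
    Literature.AlgebraicGeometry.Resolution.ResolutionInChar.{0} p

/-- The SQUEEZED crux: de Jong's reduction (Galois alteration + quotient + `WQ`) is owed over
PERFECT ground fields only, and consumes `WQ` over perfect fields only. -/
def GaloisReductionPerfect : Prop :=
  ∀ p : ℕ, p.Prime → WQPerfectAt p → PialtPerfectAt p

/-- COMPOSITION (kernel-checked): the squeezed frame and the squeezed reduction imply the crux
`WildQuotients.SummitReduction` BY NAME. [folklore] -/
theorem summitReduction_of_perfect (hF : FramePerfect) (hG : GaloisReductionPerfect) :
    Summit.ResolutionOfSingularities.ResolutionOfSingularities.Theses.WildQuotients.SummitReduction := by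
  intro p hp hWQ hPC
  have hWQ' : WQAt p := hWQ
  have hPC' : PicoverAt p := hPC
  exact hF p hp (hG p hp (wqPerfectAt_of_wqAt hWQ')) hPC'

/-! ## Card `temkin-stable-modification` -/

universe u

/-- FIRST LEMMA of card `temkin-stable-modification` — **Temkin's Stable Modification Theorem,
existence half, in de Jong's format** (Temkin, *Stable modification of relative curves*,
J. Algebraic Geom. 19 (2010) = arXiv:0707.3953, Thm 1.5 with Thm 1.1; special case: proper
connected-fibre curves, tree vocabulary `IsSemiStableCurve` = de Jong 1996, 2.21): for an integral
base `S` and a flat proper finitely presented `f : C → S` which is a semi-stable curve over some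
non-empty open of `S`, there are a generically étale ALTERATION `ψ : S' → S` and a proper
`S'`-morphism `π : C' → C ×_S S'` which is an isomorphism over a non-empty open of `S'` and
whose composite `C' → S'` is a semi-stable curve. Replaces de Jong 1997 Lemma 3.7 (moduli of
stable pointed curves with level structure) together with 3.4–3.6 (tame cyclic covers forcing
genus ≥ 2) and 3.9–3.13 (Mor-schemes + three-point contraction): the modification is OF THE GIVEN
CURVE, so it maps to `C` by construction. NAMED-FACT shape; users take `(h : TemkinStableModification)`. -/
def TemkinStableModification : Prop :=
  ∀ (S C : Scheme.{u}) [IsIntegral S] (f : C ⟶ S) [Flat f] [IsProper f]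
    [LocallyOfFinitePresentation f],
    (∃ U : S.Opens, (U : Set S).Nonempty ∧ IsSemiStableCurve (f ∣_ U)) →
      ∃ (S' : Scheme.{u}) (ψ : S' ⟶ S), IsAlteration ψ ∧ IsGenericallyEtale ψ ∧
        ∃ (C' : Scheme.{u}) (π : C' ⟶ pullback f ψ), IsProper π ∧
          (∃ V : S'.Opens, (V : Set S').Nonempty ∧
            IsIso (π ∣_ ((pullback.snd f ψ) ⁻¹ᵁ V))) ∧
          IsSemiStableCurve (π ≫ pullback.snd f ψ)

/-- SECOND STUB of card `temkin-stable-modification` — **equivariance by uniqueness** (Temkin 2010,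
Thm 1.2 / Cor 1.3 / Cor 1.6: over a NORMAL base the stable `η`-modification is minimal, unique up
to unique isomorphism, and the actions of `Aut(S)` and `Aut_S(C) × Aut_S(S')` lift to it),
finite-group form sufficient for de Jong 1997 §3/§5: if a finite group acts compatibly on
`C → S` and on the alteration `S' → S` (normal `S'`), some semi-stable modification as above
carries a compatible action. Typed loosely (existence of an equivariant one, which is what 5.9
consumes); the uniqueness statement itself needs the predicate "no exceptional components"
(Temkin §1.2), not yet in the tree. -/
def TemkinEquivariance : Prop :=
  ∀ (S C : Scheme.{u}) [IsIntegral S] (f : C ⟶ S) [Flat f] [IsProper f]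
    [LocallyOfFinitePresentation f] (G : Type u) [Group G] [Finite G]
    (ρC : G →* Aut C) (ρS : G →* Aut S),
    (∀ g : G, (ρC g).hom ≫ f = f ≫ (ρS g).hom) →
    (∃ U : S.Opens, (U : Set S).Nonempty ∧ IsSemiStableCurve (f ∣_ U)) →
      ∃ (S' : Scheme.{u}) (ψ : S' ⟶ S) (ρS' : G →* Aut S'),
        IsAlteration ψ ∧ IsGenericallyEtale ψ ∧ (∀ s : S', IsIntegrallyClosed (S'.presheaf.stalk s)) ∧
        (∀ g : G, (ρS' g).hom ≫ ψ = ψ ≫ (ρS g).hom) ∧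
        ∃ (C' : Scheme.{u}) (π : C' ⟶ pullback f ψ) (ρC' : G →* Aut C'),
          IsProper π ∧
          (∃ V : S'.Opens, (V : Set S').Nonempty ∧ IsIso (π ∣_ ((pullback.snd f ψ) ⁻¹ᵁ V))) ∧
          IsSemiStableCurve (π ≫ pullback.snd f ψ) ∧
          -- the lifted action is compatible with the action on `S'` (and hence on `C`, `S`)
          (∀ g : G, (ρC' g).hom ≫ π ≫ pullback.snd f ψ = (π ≫ pullback.snd f ψ) ≫ (ρS' g).hom)

/-! ## Card `functorial-log-endgame` -/

/-- FIRST LEMMA of card `functorial-log-endgame` — **equivariant resolution of a semi-stable pair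
over ANY field, with NO quasi-splitting and NO `G`-strictness hypotheses** (the statement that
Gabber–Illusie–Temkin's functorial monoidal desingularization of log-regular log schemes delivers:
ILO 2014 Exp. VIII (Illusie–Temkin, "Gabber's modification theorem (absolute case)", the functor
`F̃^log`), as consumed in Exp. X and in Temkin 2017 §4.2 steps 9–10; versus de Jong 1997 Prop 5.11,
which needs `f` quasi-split (Lemma 5.7) and `D` `G`-strict (dJ96 7.1/7.2)). Situation: dJ96 4.23
(`DeJong1996.SemiStablePair f g D τ`: `Y` regular projective, `D` snc, `f` semi-stable smooth off
`D`, disjoint sections `τᵢ` into the smooth locus) with a finite group acting on `X → Y`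
preserving `D` and permuting the sections. Conclusion: a `G`-equivariant proper birational
`π : X₁ → X` with `X₁` regular and the boundary pulled back into a `G`-stable snc divisor. -/
def EquivariantSemiStablePairResolution : Prop :=
  ∀ (k : Type u) [Field k] (X Y : Scheme.{u}) (f : X ⟶ Y) (g : Y ⟶ Spec (.of k)) (D : Set Y)
    (n : ℕ) (τ : Fin n → (Y ⟶ X)) (G : Type u) [Group G] [Finite G]
    (ρX : G →* Aut X) (ρY : G →* Aut Y),
    DeJong1996.SemiStablePair f g D τ →
    (∀ γ : G, (ρX γ).hom ≫ f = f ≫ (ρY γ).hom) →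
    (∀ γ : G, (ρY γ).hom.base '' D = D) →
    (∀ γ : G, ∀ i : Fin n, ∃ j : Fin n, τ i ≫ (ρX γ).hom = (ρY γ).hom ≫ τ j) →
      ∃ (X₁ : Scheme.{u}) (π : X₁ ⟶ X) (ρ₁ : G →* Aut X₁),
        IsProper π ∧ IsBirational π ∧ Scheme.IsRegular X₁ ∧
        (∀ γ : G, (ρ₁ γ).hom ≫ π = π ≫ (ρX γ).hom) ∧
        ∃ D₁ : Set X₁, IsStrictNormalCrossingsDivisor X₁ D₁ ∧
          π.base ⁻¹' (DeJong1996.semiStableBoundary f D τ) ⊆ D₁ ∧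
          (∀ γ : G, (ρ₁ γ).hom.base '' D₁ = D₁)

end Summit.ResolutionOfSingularities.ResolutionOfSingularities.Cruxes.SummitReduction.Ideator1
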